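import Summits.BirchSwinnertonDyer.BirchSwinnertonDyer.Theses.ErratumRoadFive
import Summits.BirchSwinnertonDyer.BirchSwinnertonDyer.Theorems.ErratumRoadFiveKatoFframeValueAtoms
import Summits.BirchSwinnertonDyer.BirchSwinnertonDyer.Theorems.ErratumRoadFiveKatoFframeS1Lambda
import Summits.BirchSwinnertonDyer.BirchSwinnertonDyer.Theorems.ErratumRoadFiveKatoFframeSplitLogMinimumTamagawa
import Summits.BirchSwinnertonDyer.BirchSwinnertonDyer.Theorems.ErratumRoadFiveKatoFframeNonsplitLogMinimum
import Literature.NumberTheory.EllipticCurves.Kato2004.AdmissibleZetaClassLengthInequality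
import Literature.NumberTheory.EllipticCurves.Kato2004.IwasawaH2FineSelmerDualCountRankFree
import HarnessLib

/-!
# Route `ErratumRoadFive`, crux `EulerHalfNotRamNoInertSetAtFive` (stmt-BirchSwinnertonDyer-19715), line `kato_Fframe` r5.5 —
# **the research stubs S3 / S3ns ATOMISED: print conjuncts separated from the ONE research conjunct each (a pure valuation
# inequality), in the kernel**

LEAD seat `bsd-line-er5-p1` (g10), `--supports stmt-BirchSwinnertonDyer-19715`; theorems only (no definition, no named fact, no
instance, no notation, no `sorry`). Sequel of `ErratumRoadFiveKatoFframeClosure` (p766488 / p766543): there the crux is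
`S0 (four printed named facts) + S3 + S3ns`, with S3/S3ns the registered stubs verbatim. Each of S3/S3ns is a FOUR-conjunct
existential `∃ q t, shaAn W = q ∧ HasLocPKummerLog (bottom class) t ∧ t ≠ 0 ∧ ⟨valuation inequality⟩`; the ROUTE-INDEPENDENT companion
`ErratumRoadFiveKatoFframeValueAtoms` derives each from atoms, and this file (which imports the route file, as every closer must, but
no other route-bound module) composes them with S1Λ / S2″ / S2ns into the crux. The atoms:

1. `∃ t, HasLocPKummerLog W p (bottom class of z₀) t` — AUTOMATIC in positive rank, a THEOREM
   (`ErratumRoadFiveKatoFframeValueAtoms.exists_hasLocPKummerLog_bottomClass`: with a rational point of infinite order every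
   integral class is Kummer at `p` — Perrin-Riou's Lemme 2.3.9 / Kurihara–Pollack Lemma 1.4; the bottom class is integral by
   `Kato2004.layerZeroToTop_mem_integralH1`). No reciprocity law is needed.
2. `∃ q : ℚ, shaAn W = q` — PRINT: Gross–Zagier I.(7.3) (named fact `GrossZagier1986_thm_I_7_3`, binder `hGZ`) with GZK, by the tree
   theorem `Disegni2020.exists_rat_shaAn_eq_of_analyticRank_eq_one`.
3. `t ≠ 0` — the NON-VANISHING OF KATO'S CLASS IN ANALYTIC RANK ONE at a multiplicative `p ≥ 5` with `ρ̄` onto — PRINT, taken as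
   binders (not yet typed as Literature facts): `hNZsplit` = Venerucci, Invent. math. 203 (2016), Thm. A (2) with Thm. B [conductor `Np`,
   `p > 3` split multiplicative, `A_p` irreducible, `L(A,1) = 0`: «res_p(ζ^BK) ≠ 0 iff L(A/ℚ,s) has a simple zero at s = 1»; corpus
   paper:arxiv-1407.1913 p. 3]; `hNZnonsplit` = Bertolini–Darmon–Venerucci, Adv. Math. 398 (2022), Thm. A [odd `p`, `p² ∤ N`: the
   rational form of Perrin-Riou's conjecture, in particular «res_p(z_Kato) ≠ 0 iff ord_{s=1} L(E,s) = 1»; transcription Kim, Math. Ann.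
   (2022) = arXiv:2109.12344 Thm. 2.1 / Cor. 2.3; BDV's own text is cite-only in the store, acq-02715]. In tree currency: the bottom
   layer of every ADMISSIBLE class (`Kato2004.IsAdmissibleZetaClass`, = Kato's `Ω_W`-normalised `𝐳_γ` up to `Λˣ`, so non-vanishing is
   normalisation-free) has every Kummer logarithm `t ≠ 0`.
4. the VALUATION INEQUALITY `ord_p t − 2·ord_p log_ω(x̂) ≤ ord_p q + ord_p ∏c_ℓ − 2·ord_p #E(ℚ)_tors − 1` for every such `t ≠ 0` and
   every rational `q = #Ш_an` — binders `hVsplit` (split `p`: the integral exceptional-zero value) and `hVnonsplit` (non-split `p`):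
   the ONLY research content of the line (integral rank-one Perrin-Riou values; NOT in print — see the workfile
   `Cruxes/EulerHalfNotRamNoInertSetAtFive/Lines/kato_Fframe_r5_RESIDUE_g10.md`). These two pure inequalities are what the planners
   should file as conjecture items; everything else on the line is print (by name) or proved.

HONEST FRAMING: CONDITIONAL on five named facts (S0's four + GZ86 I.(7.3)) and on the four binders of 3./4.; closes nothing; credits no
stub (the registered S3/S3ns are the bundled forms). No summit statement is proved; BSD is proved for no curve.

References: [Venerucci2016] Thm. A, Thm. B (Invent. math. 203 (2016) 923–972); [BertoliniDarmonVenerucci2022] Thm. A (Adv. Math. 398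
(2022) 108172); [Kim2022] Thm. 2.1, Cor. 2.3 (arXiv:2109.12344); [GrossZagier1986] Thm. I.(7.3); [PerrinRiou1993AIF] Lemme 2.3.9,
§3.3; [KuriharaPollack2007] Lemma 1.4; [Kato2004Asterisque] §8.2, Thm. 12.5 (4); [Darmon2004] Thm. 3.22.
-/

-- the summit and its single problem are both named `BirchSwinnertonDyer` (registry layout D-0017)
set_option linter.dupNamespace false
set_option autoImplicit false

noncomputable section

open scoped Classical
open Field WeierstrassCurve
open Literature.NumberTheory.GaloisRepresentations
open Literature.NumberTheory.EllipticCurves Literature.NumberTheory.EllipticCurves.Kato2004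
open Literature.NumberTheory.EllipticCurves.Kato2004.EulerSystemValues
open Literature.NumberTheory.EllipticCurves.Rank1Residual
open Literature.NumberTheory.EllipticCurves.Rank1Residual.Typed
open Summit.BirchSwinnertonDyer.Rank1Residual
open Summit.BirchSwinnertonDyer.BirchSwinnertonDyer.Theses.ErratumRoadFive

namespace Summit.BirchSwinnertonDyer.BirchSwinnertonDyer.Theorems.ErratumRoadFiveKatoFframeClosureAtomic

/-! ## §1 The Euler half on X11b ∩ {p ≥ 5, ρ̄ onto} and crux 19715 from: five printed facts, two printed non-vanishings, and
the two research INEQUALITIES — nothing else -/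

/-- **`Typed.MissingUpperBoundAt W p` on ALL of X11b ∩ {p ≥ 5, ρ̄ onto} from the atoms**: S0's four named facts (`hGZK`, `hReal`,
`hF1`, `hH2X`), Gross–Zagier I.(7.3) (`hGZ`), the rank-one non-vanishing of Kato's class at split / non-split multiplicative `p`
(`hNZsplit` = Venerucci 2016, `hNZnonsplit` = BDV 2022; print, binders), and the two pure valuation inequalities `hVsplit` /
`hVnonsplit` (RESEARCH). Composition = the workfile's `EulerHalfNotRamNoInertSetAtFive_of` body over
`ErratumRoadFiveKatoFframeValueAtoms.integral{ExcZero,Nonsplit}Value_of_atoms`, S1Λ (p765646) and S2″/S2ns; the graded arithmetic is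
discharged by `omega`. CONDITIONAL; closes nothing. [cite: Kato2004Asterisque, Thm. 12.4 (3), Thm. 12.5 (4) (pp. 221–222), (14.9.3), (14.14.2)]
[cite: Venerucci2016, Thm. A and Thm. B] [cite: BertoliniDarmonVenerucci2022, Thm. A] [cite: GrossZagier1986, Thm. I.(7.3)] [cite: Darmon2004, Thm. 3.22] -/
theorem missingUpperBoundAt_of_atoms
    (hGZK : rank_eq_analyticRank_of_analyticRank_le_one)
    (hReal : exists_isAdmissibleZetaClass_of_imageContainsSL2)
    (hF1 : lengthAt_fineSelmerDual_le_of_isAdmissibleZetaClass)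
    (hH2X : exists_iwasawaH2Data_fineSelmerDual_embedding_countRankFree)
    (hGZ : GrossZagier1986_thm_I_7_3)
    (hNZsplit : ∀ (W : WeierstrassCurve ℚ) [W.IsElliptic] [W.IsGloballyMinimal] (p : ℕ) [Fact p.Prime]
      [ContinuousSMul ℤ_[p] (W.tateModule p)],
      5 ≤ p → Surj W p → W.analyticRank = 1 → W.HasSplitMultiplicativeReductionAtPrime p →
      ∀ (K : ZpExtension ℚ p) (hK : K.IsCyclotomic) (γ : absoluteGaloisGroup ℚ)
        (I : IwasawaH1Data W p K γ) (z₀ : I.H), K.IsTopGenerator γ → IsAdmissibleZetaClass W p K hK I z₀ →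
      ∀ t : ℚ_[p], HasLocPKummerLog W p (layerZeroToTop W p K (I.proj 0 z₀)) t → t ≠ 0)
    (hNZnonsplit : ∀ (W : WeierstrassCurve ℚ) [W.IsElliptic] [W.IsGloballyMinimal] (p : ℕ) [Fact p.Prime]
      [ContinuousSMul ℤ_[p] (W.tateModule p)],
      5 ≤ p → Surj W p → W.analyticRank = 1 → W.HasMultiplicativeReductionAtPrime p →
      ¬ W.HasSplitMultiplicativeReductionAtPrime p →
      ∀ (K : ZpExtension ℚ p) (hK : K.IsCyclotomic) (γ : absoluteGaloisGroup ℚ)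
        (I : IwasawaH1Data W p K γ) (z₀ : I.H), K.IsTopGenerator γ → IsAdmissibleZetaClass W p K hK I z₀ →
      ∀ t : ℚ_[p], HasLocPKummerLog W p (layerZeroToTop W p K (I.proj 0 z₀)) t → t ≠ 0)
    (hVsplit : ∀ (W : WeierstrassCurve ℚ) [W.IsElliptic] [W.IsGloballyMinimal] (p : ℕ) [Fact p.Prime]
      [ContinuousSMul ℤ_[p] (W.tateModule p)],
      ClassX11b W p → 5 ≤ p → Surj W p → W.HasSplitMultiplicativeReductionAtPrime p →
      ∀ (h1 : W.mordellWeilRank = 1) (P : Fin W.mordellWeilRank → W.toAffine.Point),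
        W.IsMordellWeilBasis P →
      ∀ (K : ZpExtension ℚ p) (hK : K.IsCyclotomic) (γ : absoluteGaloisGroup ℚ)
        (I : IwasawaH1Data W p K γ) (z₀ : I.H), K.IsTopGenerator γ → IsAdmissibleZetaClass W p K hK I z₀ →
      ∀ t : ℚ_[p], HasLocPKummerLog W p (layerZeroToTop W p K (I.proj 0 z₀)) t → t ≠ 0 →
      ∀ q : ℚ, shaAn W = (q : ℂ) →
        t.valuation -
            2 * (padicLogLocal W p (WeierstrassCurve.Affine.Point.map (Algebra.ofId ℚ ℚ_[p]) (P (Fin.cast h1.symm 0)))).valuation ≤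
          padicValRat p q + padicValNat p W.tamagawaProduct - 2 * padicValNat p W.torsionOrder - 1)
    (hVnonsplit : ∀ (W : WeierstrassCurve ℚ) [W.IsElliptic] [W.IsGloballyMinimal] (p : ℕ) [Fact p.Prime]
      [ContinuousSMul ℤ_[p] (W.tateModule p)],
      ClassX11b W p → 5 ≤ p → Surj W p → ¬ W.HasSplitMultiplicativeReductionAtPrime p →
      ∀ (h1 : W.mordellWeilRank = 1) (P : Fin W.mordellWeilRank → W.toAffine.Point),
        W.IsMordellWeilBasis P →
      ∀ (K : ZpExtension ℚ p) (hK : K.IsCyclotomic) (γ : absoluteGaloisGroup ℚ)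
        (I : IwasawaH1Data W p K γ) (z₀ : I.H), K.IsTopGenerator γ → IsAdmissibleZetaClass W p K hK I z₀ →
      ∀ t : ℚ_[p], HasLocPKummerLog W p (layerZeroToTop W p K (I.proj 0 z₀)) t → t ≠ 0 →
      ∀ q : ℚ, shaAn W = (q : ℂ) →
        t.valuation -
            2 * (padicLogLocal W p (WeierstrassCurve.Affine.Point.map (Algebra.ofId ℚ ℚ_[p]) (P (Fin.cast h1.symm 0)))).valuation ≤
          padicValRat p q + padicValNat p W.tamagawaProduct - 2 * padicValNat p W.torsionOrder - 1) :
    ∀ (W : WeierstrassCurve ℚ) [W.IsElliptic] [W.IsGloballyMinimal] (p : ℕ) [Fact p.Prime],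
      ClassX11b W p → 5 ≤ p → Surj W p → MissingUpperBoundAt W p := by
  -- the two bundled value statements from their atoms (route-independent companion file)
  have hS3 := ErratumRoadFiveKatoFframeValueAtoms.integralExcZeroValue_of_atoms hGZK hGZ hNZsplit hVsplit
  have hS3n := ErratumRoadFiveKatoFframeValueAtoms.integralNonsplitValue_of_atoms hGZK hGZ hNZnonsplit hVnonsplit
  -- S1Λ (p765646) and the Tate-curve minima S2″ / S2ns (width files)
  have hS1 := ErratumRoadFiveKatoFframeS1Lambda.katoLambdaLogBoundTamagawa hGZK hF1 hH2X
  have hS2 := ErratumRoadFiveKatoFframeSplitLogMinimumTamagawa.tateUniformisationLogMinimumTamagawa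
  have hS2n := ErratumRoadFiveKatoFframeNonsplitLogMinimum.nonsplitLogMinimum
  -- the composition (body of the workfile's `EulerHalfNotRamNoInertSetAtFive_of`, `bottomClass`/`logOmega` unfolded)
  intro W _ _ p _ hX h5 hSurj
  haveI : ContinuousSMul ℤ_[p] (W.tateModule p) := TateModule.continuousSMul_padicInt
  have hr1 : W.analyticRank = 1 := hX.1
  have hmult : W.HasMultiplicativeReductionAtPrime p := hX.2.2.1
  have hmw : W.mordellWeilRank = 1 := by
    have h := (hGZK W (le_of_eq hr1)).1
    omega
  obtain ⟨P, hP⟩ := W.exists_isMordellWeilBasis_holds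
  obtain ⟨K, hK, γ, I, z₀, hγ, hz⟩ := hReal.exists_datum_of_hasSurjectiveModNGaloisRep W p h5 hSurj
  by_cases hsplit : W.HasSplitMultiplicativeReductionAtPrime p
  · obtain ⟨q, t, hq, ht, ht0, hC⟩ := hS3 W p hX h5 hSurj hsplit hmw P hP K hK γ I z₀ hγ hz
    obtain ⟨hcp, m, Q₀, Q, hQ₀, hQ0, hQv⟩ := hS2 W p h5 hsplit
    refine ⟨q, hq, ?_⟩
    have hB := hS1 W p h5 hSurj hr1 hmult hmw P hP K hK γ I z₀ hγ hz t ht ht0 m Q₀ hQ₀ Q hQ0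
    rw [hcp] at hB
    have htors : (0 : ℤ) ≤ padicValNat p W.torsionOrder := by positivity
    omega
  · obtain ⟨q, t, hq, ht, ht0, hC⟩ := hS3n W p hX h5 hSurj hsplit hmw P hP K hK γ I z₀ hγ hz
    obtain ⟨hc0, Q, hQ0, hQv⟩ := hS2n W p h5 hmult hsplit
    refine ⟨q, hq, ?_⟩
    have hB := hS1 W p h5 hSurj hr1 hmult hmw P hP K hK γ I z₀ hγ hz t ht ht0 0 0 (by simp) Q hQ0
    rw [hc0] at hB
    have htors : (0 : ℤ) ≤ padicValNat p W.torsionOrder := by positivity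
    omega

/-- **Crux 19715 `ErratumRoadFive.EulerHalfNotRamNoInertSetAtFive` from the atoms** (the crux decl BY NAME; its three residual
hypotheses are idle): five printed named facts, the two printed rank-one non-vanishings of Kato's class, and the two research
valuation inequalities. CONDITIONAL; closes nothing. [cite: Kato2004Asterisque, Thm. 12.5 (4) (p. 222)] [cite: Venerucci2016, Thm. A and Thm. B]
[cite: BertoliniDarmonVenerucci2022, Thm. A] [cite: GrossZagier1986, Thm. I.(7.3)] [cite: Darmon2004, Thm. 3.22] -/
theorem eulerHalfNotRamNoInertSetAtFive_of_atoms
    (hGZK : rank_eq_analyticRank_of_analyticRank_le_one)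
    (hReal : exists_isAdmissibleZetaClass_of_imageContainsSL2)
    (hF1 : lengthAt_fineSelmerDual_le_of_isAdmissibleZetaClass)
    (hH2X : exists_iwasawaH2Data_fineSelmerDual_embedding_countRankFree)
    (hGZ : GrossZagier1986_thm_I_7_3)
    (hNZsplit : ∀ (W : WeierstrassCurve ℚ) [W.IsElliptic] [W.IsGloballyMinimal] (p : ℕ) [Fact p.Prime]
      [ContinuousSMul ℤ_[p] (W.tateModule p)],
      5 ≤ p → Surj W p → W.analyticRank = 1 → W.HasSplitMultiplicativeReductionAtPrime p →
      ∀ (K : ZpExtension ℚ p) (hK : K.IsCyclotomic) (γ : absoluteGaloisGroup ℚ)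
        (I : IwasawaH1Data W p K γ) (z₀ : I.H), K.IsTopGenerator γ → IsAdmissibleZetaClass W p K hK I z₀ →
      ∀ t : ℚ_[p], HasLocPKummerLog W p (layerZeroToTop W p K (I.proj 0 z₀)) t → t ≠ 0)
    (hNZnonsplit : ∀ (W : WeierstrassCurve ℚ) [W.IsElliptic] [W.IsGloballyMinimal] (p : ℕ) [Fact p.Prime]
      [ContinuousSMul ℤ_[p] (W.tateModule p)],
      5 ≤ p → Surj W p → W.analyticRank = 1 → W.HasMultiplicativeReductionAtPrime p →
      ¬ W.HasSplitMultiplicativeReductionAtPrime p →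
      ∀ (K : ZpExtension ℚ p) (hK : K.IsCyclotomic) (γ : absoluteGaloisGroup ℚ)
        (I : IwasawaH1Data W p K γ) (z₀ : I.H), K.IsTopGenerator γ → IsAdmissibleZetaClass W p K hK I z₀ →
      ∀ t : ℚ_[p], HasLocPKummerLog W p (layerZeroToTop W p K (I.proj 0 z₀)) t → t ≠ 0)
    (hVsplit : ∀ (W : WeierstrassCurve ℚ) [W.IsElliptic] [W.IsGloballyMinimal] (p : ℕ) [Fact p.Prime]
      [ContinuousSMul ℤ_[p] (W.tateModule p)],
      ClassX11b W p → 5 ≤ p → Surj W p → W.HasSplitMultiplicativeReductionAtPrime p →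
      ∀ (h1 : W.mordellWeilRank = 1) (P : Fin W.mordellWeilRank → W.toAffine.Point),
        W.IsMordellWeilBasis P →
      ∀ (K : ZpExtension ℚ p) (hK : K.IsCyclotomic) (γ : absoluteGaloisGroup ℚ)
        (I : IwasawaH1Data W p K γ) (z₀ : I.H), K.IsTopGenerator γ → IsAdmissibleZetaClass W p K hK I z₀ →
      ∀ t : ℚ_[p], HasLocPKummerLog W p (layerZeroToTop W p K (I.proj 0 z₀)) t → t ≠ 0 →
      ∀ q : ℚ, shaAn W = (q : ℂ) →
        t.valuation -
            2 * (padicLogLocal W p (WeierstrassCurve.Affine.Point.map (Algebra.ofId ℚ ℚ_[p]) (P (Fin.cast h1.symm 0)))).valuation ≤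
          padicValRat p q + padicValNat p W.tamagawaProduct - 2 * padicValNat p W.torsionOrder - 1)
    (hVnonsplit : ∀ (W : WeierstrassCurve ℚ) [W.IsElliptic] [W.IsGloballyMinimal] (p : ℕ) [Fact p.Prime]
      [ContinuousSMul ℤ_[p] (W.tateModule p)],
      ClassX11b W p → 5 ≤ p → Surj W p → ¬ W.HasSplitMultiplicativeReductionAtPrime p →
      ∀ (h1 : W.mordellWeilRank = 1) (P : Fin W.mordellWeilRank → W.toAffine.Point),
        W.IsMordellWeilBasis P →
      ∀ (K : ZpExtension ℚ p) (hK : K.IsCyclotomic) (γ : absoluteGaloisGroup ℚ)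
        (I : IwasawaH1Data W p K γ) (z₀ : I.H), K.IsTopGenerator γ → IsAdmissibleZetaClass W p K hK I z₀ →
      ∀ t : ℚ_[p], HasLocPKummerLog W p (layerZeroToTop W p K (I.proj 0 z₀)) t → t ≠ 0 →
      ∀ q : ℚ, shaAn W = (q : ℂ) →
        t.valuation -
            2 * (padicLogLocal W p (WeierstrassCurve.Affine.Point.map (Algebra.ofId ℚ ℚ_[p]) (P (Fin.cast h1.symm 0)))).valuation ≤
          padicValRat p q + padicValNat p W.tamagawaProduct - 2 * padicValNat p W.torsionOrder - 1) :
    EulerHalfNotRamNoInertSetAtFive := by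
  intro W _ _ p _ hX h5 hSurj _hnRam _hTam _hNoS
  exact missingUpperBoundAt_of_atoms hGZK hReal hF1 hH2X hGZ hNZsplit hNZnonsplit hVsplit hVnonsplit W p hX h5 hSurj

end Summit.BirchSwinnertonDyer.BirchSwinnertonDyer.Theorems.ErratumRoadFiveKatoFframeClosureAtomic

end
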